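import Summits.QuantumFields.YangMills.Theorems.LuscherReductionDressedRitzPolyakovLiftClusterInduction
import Summits.QuantumFields.YangMills.Theorems.FemtoTransferGapPhysL2
import HarnessLib

/-!
# CLUSTER CONCENTRATION IN `l2`∕`qform` CURRENCY (F9-plan §5 + (iii) for S-PSCAL″ of crux `DressedRitz`, stmt-QuantumFields-20205,
# line «polyakovlift» r6; seat ym-20205-polyakovlift-w1a g1, helper `--supports`)

The tree's pure-linear-algebra `ClusterInd.cluster_induction` (LEAD g2, `…PolyakovLiftClusterInduction`) is instantiated on PHYSICAL TEST
FUNCTIONS of the fixed-lattice `SU(2)` theory (any lattice size `L`), with its two hypotheses produced from tree currencies: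

* §1 a down-closed subset of `Fin M` is an initial segment (bookkeeping for monotone cluster maps);
* §2 ★ `firstMoment_split`: for an `l2`-orthonormal physical eigen-family `e_k` (`K_β e_k = λ_k e_k`, Courant–Fischer domination — exactly the
  first three conjuncts of `SpecSum.exists_spectral_eigenseq`, taken as HYPOTHESES so that the caller's `e` is shared) and physical `ψ`:
  `⟨ψ, K_β ψ⟩ ≤ Σ_{k<m} λ_k ⟨ψ,e_k⟩² + λ_m (‖ψ‖² − Σ_{k<m} ⟨ψ,e_k⟩²)` and finite Bessel (no `HasSum`, no completeness);
* §3 ★ `out_le_of_firstMoment`: `θ‖ψ‖² ≤ ⟨ψ,K_βψ⟩` forces `(λ_m − λ_{m′})(‖ψ‖² − Σ_{k<m′}⟨ψ,e_k⟩²) ≤ (λ_m − θ)‖ψ‖² + (λ_0 − λ_m)Σ_{k<m}⟨ψ,e_k⟩²`;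
* §4 ★★ `cluster_concentration` (+ `_range`, `_in`): for physical `Ψ_j` (`j : Fin M`) with a monotone cluster map, near-orthogonality, first
  moments and cluster gaps, `lo_j + out_j ≤ clusterDelta M κ ε s M · ‖Ψ_j‖²` and `(1 − δ)‖Ψ_j‖² ≤ in_j` — the tree's `cluster_induction`
  transported to `Lp ℝ 2 (configMeasure SU2 L)` through `PhysL2.toL2`; the per-vector NORM-CURRENCY datum of the LEAD's F9 design (bus 19:23:42Z).
HONEST FRAMING: finite-dimensional spectral bookkeeping on a fixed lattice; nothing here bears on infinite volume, the continuum limit or the Clay gap.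
References: Reed–Simon IV, Thm. XIII.1 [cite: ReedSimonIV1978, Thm. XIII.1].
-/

set_option autoImplicit false

noncomputable section

open Finset MeasureTheory
open Literature.MathematicalPhysics.QuantumFieldTheory
open Literature.MathematicalPhysics.QuantumLattice
open Literature.Analysis.OperatorTheory.YMMatrixModel
open scoped BigOperators RealInnerProductSpace

namespace Summit.QuantumFields.YangMills.Theorems.FemtoTransferGap.ClusterConc

open Summit.QuantumFields.YangMills.Theorems.FemtoTransferGap
open Summit.QuantumFields.YangMills.Theorems.FemtoTransferGap.ClusterInd
open Summit.QuantumFields.YangMills.Theorems.FemtoTransferGap.PhysL2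

/-! ## §1 Down-closed subsets of `Fin M` are initial segments -/

/-- A down-closed finite subset `S ⊆ Fin M` is the initial segment `{j | j < #S}`. [folklore] -/
theorem mem_iff_lt_card_of_downClosed {M : ℕ} (S : Finset (Fin M)) (hS : ∀ a b : Fin M, a ≤ b → b ∈ S → a ∈ S) (j : Fin M) :
    j ∈ S ↔ (j : ℕ) < S.card := by
  constructor
  · intro hj
    have hsub : Finset.Iic j ⊆ S := fun i hi => hS i j (Finset.mem_Iic.1 hi) hj
    have := card_le_card hsub
    rw [Fin.card_Iic] at this
    omega
  · intro hj
    by_contra hnot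
    have hsub : S ⊆ Finset.Iio j := by
      intro i hi
      rw [Finset.mem_Iio]
      by_contra hle
      exact hnot (hS j i (not_lt.1 hle) hi)
    have := card_le_card hsub
    rw [Fin.card_Iio] at this
    omega

/-- For a monotone `cl : Fin M → ℕ`, `{j′ | cl j′ < cl j}` is the initial segment of length its cardinality. [folklore] -/
theorem mem_filter_lt_iff {M : ℕ} (cl : Fin M → ℕ) (hcl : Monotone cl) (j j' : Fin M) :
    j' ∈ univ.filter (fun i => cl i < cl j) ↔ (j' : ℕ) < (univ.filter (fun i => cl i < cl j)).card := by
  refine mem_iff_lt_card_of_downClosed _ (fun a b hab hb => ?_) j'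
  simp only [mem_filter, mem_univ, true_and] at hb ⊢
  exact (hcl hab).trans_lt hb

/-- For a monotone `cl : Fin M → ℕ`, `{j′ | cl j′ ≤ cl j}` is the initial segment of length its cardinality. [folklore] -/
theorem mem_filter_le_iff {M : ℕ} (cl : Fin M → ℕ) (hcl : Monotone cl) (j j' : Fin M) :
    j' ∈ univ.filter (fun i => cl i ≤ cl j) ↔ (j' : ℕ) < (univ.filter (fun i => cl i ≤ cl j)).card := by
  refine mem_iff_lt_card_of_downClosed _ (fun a b hab hb => ?_) j'
  simp only [mem_filter, mem_univ, true_and] at hb ⊢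
  exact (hcl hab).trans hb

/-- Re-indexing: a sum over an initial-segment filter of `Fin M` is a sum over `range`. [folklore] -/
theorem sum_filter_eq_sum_range {M : ℕ} (S : Finset (Fin M)) (hS : ∀ j' : Fin M, j' ∈ S ↔ (j' : ℕ) < S.card) (f : ℕ → ℝ) :
    ∑ j' ∈ S, f j' = ∑ k ∈ range S.card, f k := by
  have hSM : S.card ≤ M := by simpa using card_le_univ S
  have hmap := sum_map S Fin.valEmbedding f
  simp only [Fin.valEmbedding_apply] at hmap
  rw [← hmap]
  congr 1
  ext k
  simp only [mem_map, Fin.valEmbedding_apply, mem_range]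
  constructor
  · rintro ⟨j', hj', rfl⟩; exact (hS j').1 hj'
  · intro hk; exact ⟨⟨k, by omega⟩, (hS _).2 hk, rfl⟩

/-! ## §2 First-moment split against an exact orthonormal eigen-family -/

variable {L : ℕ} [NeZero L]

section Split

variable {β : ℝ} (e : ℕ → physSubmodule L)
  (hon : ∀ i l, l2 ((e i : physSubmodule L) : GaugeConfig 3 L SU2 → ℝ) (e l) = if i = l then 1 else 0)
  (heig : ∀ k, transferApply β ((e k : physSubmodule L) : GaugeConfig 3 L SU2 → ℝ) =
    levelValue su2Rep L β k • ((e k : physSubmodule L) : GaugeConfig 3 L SU2 → ℝ))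
  (hdom : ∀ (k : ℕ) (ψ : GaugeConfig 3 L SU2 → ℝ), IsPhys ψ →
    (∀ i, i < k → l2 ψ ((e i : physSubmodule L) : GaugeConfig 3 L SU2 → ℝ) = 0) →
      qform su2Rep β ψ ψ ≤ levelValue su2Rep L β k * l2 ψ ψ)

include hon in
/-- `l2Form (e k) (e i) = δ_{ki}`. [folklore] -/
theorem l2Form_e_e (k i : ℕ) : l2Form L (e k) (e i) = if k = i then 1 else 0 := by
  rw [l2Form_apply]; exact hon k i

include heig in
/-- `transferOp β (e k) = λ_k • e k` in the physical submodule. [folklore] -/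
theorem transferOp_e (k : ℕ) : transferOp β (e k) = levelValue su2Rep L β k • e k := by
  apply Subtype.ext
  rw [coe_transferOp, heig k, Submodule.coe_smul]

/-- Pairing a finite `e`-combination on the left: `⟨Σ c_k e_k, z⟩ = Σ c_k ⟨e_k, z⟩`. [folklore] -/
theorem l2Form_sum_smul_left (s : Finset ℕ) (c : ℕ → ℝ) (z : physSubmodule L) :
    l2Form L (∑ k ∈ s, c k • e k) z = ∑ k ∈ s, c k * l2Form L (e k) z := by
  simp only [map_sum, map_smul, LinearMap.coe_sum, Finset.sum_apply, LinearMap.smul_apply, smul_eq_mul]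

/-- Pairing a finite `e`-combination on the right: `⟨z, Σ c_k e_k⟩ = Σ c_k ⟨z, e_k⟩`. [folklore] -/
theorem l2Form_sum_smul_right (s : Finset ℕ) (c : ℕ → ℝ) (z : physSubmodule L) :
    l2Form L z (∑ k ∈ s, c k • e k) = ∑ k ∈ s, c k * l2Form L z (e k) := by
  simp only [map_sum, map_smul, smul_eq_mul]

include hon in
/-- `⟨Σ_{k∈s} c_k e_k, e_i⟩ = c_i` for `i ∈ s`. [folklore] -/
theorem l2Form_sum_smul_e (s : Finset ℕ) (c : ℕ → ℝ) {i : ℕ} (hi : i ∈ s) :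
    l2Form L (∑ k ∈ s, c k • e k) (e i) = c i := by
  rw [l2Form_sum_smul_left e]
  simp only [l2Form_e_e e hon, mul_ite, mul_one, mul_zero, Finset.sum_ite_eq', hi, if_true]

include hon in
/-- `⟨e_i, Σ_{k∈s} c_k e_k⟩ = c_i` for `i ∈ s`. [folklore] -/
theorem l2Form_e_sum_smul (s : Finset ℕ) (c : ℕ → ℝ) {i : ℕ} (hi : i ∈ s) :
    l2Form L (e i) (∑ k ∈ s, c k • e k) = c i := by
  rw [l2Form_symm]; exact l2Form_sum_smul_e e hon s c hi

include hon heig hdom in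
/-- ★ **First-moment split.**  For physical `ψ` and every `m`:
`⟨ψ,K_βψ⟩ ≤ Σ_{k<m} λ_k ⟨ψ,e_k⟩² + λ_m (‖ψ‖² − Σ_{k<m}⟨ψ,e_k⟩²)` (exact on the span of `e_0..e_{m−1}`, domination on the remainder),
together with finite Bessel `Σ_{k<m}⟨ψ,e_k⟩² ≤ ‖ψ‖²`. [cite: ReedSimonIV1978, Thm. XIII.1] -/
theorem firstMoment_split {ψ : GaugeConfig 3 L SU2 → ℝ} (hψ : IsPhys ψ) (m : ℕ) :
    (∑ k ∈ range m, l2 ψ ((e k : physSubmodule L) : GaugeConfig 3 L SU2 → ℝ) ^ 2 ≤ l2 ψ ψ) ∧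
    qform su2Rep β ψ ψ ≤ ∑ k ∈ range m, levelValue su2Rep L β k * l2 ψ ((e k : physSubmodule L) : GaugeConfig 3 L SU2 → ℝ) ^ 2 +
      levelValue su2Rep L β m * (l2 ψ ψ - ∑ k ∈ range m, l2 ψ ((e k : physSubmodule L) : GaugeConfig 3 L SU2 → ℝ) ^ 2) := by
  let x : physSubmodule L := ⟨ψ, hψ⟩
  let a : ℕ → ℝ := fun k => l2Form L x (e k)
  have ha : ∀ k, l2 ψ ((e k : physSubmodule L) : GaugeConfig 3 L SU2 → ℝ) = a k := fun k => rfl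
  have hxx : l2 ψ ψ = l2Form L x x := rfl
  have hq : qform su2Rep β ψ ψ = l2Form L x (transferOp β x) := by rw [l2Form_transferOp_right]
  simp only [ha]
  rw [hxx, hq]
  let P : physSubmodule L := ∑ k ∈ range m, a k • e k
  let r : physSubmodule L := x - P
  have hBPe : ∀ i ∈ range m, l2Form L P (e i) = a i := fun i hi => l2Form_sum_smul_e e hon _ _ hi
  have hBxP : l2Form L x P = ∑ k ∈ range m, a k ^ 2 := by
    show l2Form L x (∑ k ∈ range m, a k • e k) = _
    rw [l2Form_sum_smul_right e]
    exact sum_congr rfl fun k _ => by ring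
  have hBPP : l2Form L P P = ∑ k ∈ range m, a k ^ 2 := by
    show l2Form L (∑ k ∈ range m, a k • e k) (∑ k ∈ range m, a k • e k) = _
    rw [l2Form_sum_smul_left e]
    refine sum_congr rfl fun k hk => ?_
    rw [l2Form_e_sum_smul e hon _ _ hk]; ring
  have hre : ∀ i, i < m → l2Form L r (e i) = 0 := by
    intro i hi
    show l2Form L (x - P) (e i) = 0
    rw [map_sub, LinearMap.sub_apply, hBPe i (mem_range.2 hi)]
    exact sub_self _
  have hBrr : l2Form L r r = l2Form L x x - ∑ k ∈ range m, a k ^ 2 := by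
    show l2Form L (x - P) (x - P) = _
    simp only [map_sub, LinearMap.sub_apply]
    rw [hBxP, hBPP, l2Form_symm P x, hBxP]
    ring
  have hTP : transferOp β P = ∑ k ∈ range m, (a k * levelValue su2Rep L β k) • e k := by
    show transferOp β (∑ k ∈ range m, a k • e k) = _
    rw [map_sum]; refine sum_congr rfl fun k _ => ?_
    rw [map_smul, transferOp_e e heig, smul_smul]
  have hBPTP : l2Form L P (transferOp β P) = ∑ k ∈ range m, levelValue su2Rep L β k * a k ^ 2 := by
    rw [hTP, l2Form_sum_smul_right e]
    refine sum_congr rfl fun k hk => ?_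
    rw [hBPe k hk]; ring
  have hBrTP : l2Form L r (transferOp β P) = 0 := by
    rw [hTP, l2Form_sum_smul_right e]
    exact sum_eq_zero fun k hk => by rw [hre k (mem_range.1 hk), mul_zero]
  have hBPTr : l2Form L P (transferOp β r) = 0 := by
    rw [← transferOp_symm, l2Form_symm, hBrTP]
  -- the split identity `⟨x, T x⟩ = Σ λ_k a_k² + ⟨r, T r⟩`
  have hsplit : l2Form L x (transferOp β x) = ∑ k ∈ range m, levelValue su2Rep L β k * a k ^ 2 + l2Form L r (transferOp β r) := by
    have hxd : x = P + r := by show x = P + (x - P); abel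
    rw [hxd]
    simp only [map_add, LinearMap.add_apply]
    rw [hBPTP, hBPTr, hBrTP]
    ring
  have hdomr : l2Form L r (transferOp β r) ≤ levelValue su2Rep L β m * l2Form L r r := by
    rw [l2Form_transferOp_right, l2Form_apply]
    exact hdom m _ (isPhys_coe r) fun i hi => by
      have := hre i hi; rwa [l2Form_apply] at this
  have hrr0 : 0 ≤ l2Form L r r := l2Form_self_nonneg r
  refine ⟨?_, ?_⟩
  · linarith [hBrr]
  · rw [hsplit, ← hBrr]; linarith [hdomr]

/-! ## §3 Mass outside the clusters from a first-moment lower bound -/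

include hon heig hdom in
/-- ★ **Out-mass bound.**  If `θ‖ψ‖² ≤ ⟨ψ,K_βψ⟩` (`λ` antitone, `m ≤ m′`) then
`(λ_m − λ_{m′})(‖ψ‖² − Σ_{k<m′}⟨ψ,e_k⟩²) ≤ (λ_m − θ)‖ψ‖² + (λ_0 − λ_m) Σ_{k<m}⟨ψ,e_k⟩²`: the first moment splits as
`≤ λ_0·lo + λ_m·in + λ_{m′}·rest`. [cite: ReedSimonIV1978, Thm. XIII.1] -/
theorem out_le_of_firstMoment (hanti : Antitone fun k => levelValue su2Rep L β k) {ψ : GaugeConfig 3 L SU2 → ℝ} (hψ : IsPhys ψ) {m m' : ℕ} (hmm : m ≤ m') {θ : ℝ}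
    (hθ : θ * l2 ψ ψ ≤ qform su2Rep β ψ ψ) :
    (levelValue su2Rep L β m - levelValue su2Rep L β m') *
        (l2 ψ ψ - ∑ k ∈ range m', l2 ψ ((e k : physSubmodule L) : GaugeConfig 3 L SU2 → ℝ) ^ 2) ≤
      (levelValue su2Rep L β m - θ) * l2 ψ ψ +
        (levelValue su2Rep L β 0 - levelValue su2Rep L β m) * ∑ k ∈ range m, l2 ψ ((e k : physSubmodule L) : GaugeConfig 3 L SU2 → ℝ) ^ 2 := by
  set lam : ℕ → ℝ := fun k => levelValue su2Rep L β k with hlam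
  set a : ℕ → ℝ := fun k => l2 ψ ((e k : physSubmodule L) : GaugeConfig 3 L SU2 → ℝ) with ha
  obtain ⟨-, hsp⟩ := firstMoment_split e hon heig hdom hψ m'
  have hlo : ∑ k ∈ range m, lam k * a k ^ 2 ≤ lam 0 * ∑ k ∈ range m, a k ^ 2 := by
    rw [mul_sum]; exact sum_le_sum fun k _ => mul_le_mul_of_nonneg_right (hanti (Nat.zero_le k)) (sq_nonneg _)
  have hin : ∑ k ∈ Ico m m', lam k * a k ^ 2 ≤ lam m * ∑ k ∈ Ico m m', a k ^ 2 := by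
    rw [mul_sum]; exact sum_le_sum fun k hk => mul_le_mul_of_nonneg_right (hanti (mem_Ico.1 hk).1) (sq_nonneg _)
  have hsplit1 : ∑ k ∈ range m', lam k * a k ^ 2 = ∑ k ∈ range m, lam k * a k ^ 2 + ∑ k ∈ Ico m m', lam k * a k ^ 2 := by
    rw [range_eq_Ico, range_eq_Ico, ← sum_Ico_consecutive _ (Nat.zero_le m) hmm]
  have hsplit2 : ∑ k ∈ range m', a k ^ 2 = ∑ k ∈ range m, a k ^ 2 + ∑ k ∈ Ico m m', a k ^ 2 := by
    rw [range_eq_Ico, range_eq_Ico, ← sum_Ico_consecutive _ (Nat.zero_le m) hmm]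
  have key : θ * l2 ψ ψ ≤ lam 0 * ∑ k ∈ range m, a k ^ 2 + lam m * ∑ k ∈ Ico m m', a k ^ 2 +
      lam m' * (l2 ψ ψ - ∑ k ∈ range m', a k ^ 2) := by
    have := hθ.trans hsp
    rw [hsplit1] at this
    linarith
  rw [hsplit2] at key ⊢
  nlinarith [key]

/-! ## §4 ★★ Cluster concentration of physical quasimodes -/

/-- For a monotone-labelled family, `#{cl j′ < cl j} ≤ #{cl j′ ≤ cl j} ≤ M`. [folklore] -/
theorem card_filter_lt_le_card_filter_le {M : ℕ} (cl : Fin M → ℕ) (j : Fin M) :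
    (univ.filter fun j' => cl j' < cl j).card ≤ (univ.filter fun j' => cl j' ≤ cl j).card ∧
      (univ.filter fun j' => cl j' ≤ cl j).card ≤ M := by
  refine ⟨card_le_card fun i hi => ?_, by simpa using card_le_univ (univ.filter fun j' => cl j' ≤ cl j)⟩
  simp only [mem_filter, mem_univ, true_and] at hi ⊢
  exact hi.le

include hon heig hdom in
/-- ★★ **CLUSTER CONCENTRATION (l2 currency).**  Fixed lattice, `β ≥ 0`; `e_k` an `l2`-orthonormal physical eigen-family with eigenvalues
`λ_k = levelValue … k` and Courant–Fischer domination (the first three conjuncts of `SpecSum.exists_spectral_eigenseq`); physical `Ψ_j ≠ 0`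
(`j : Fin M`) with a monotone cluster map `cl`; near-orthogonality `|⟨Ψ_j,Ψ_j′⟩| ≤ ε‖Ψ_j‖‖Ψ_j′‖` (`j ≠ j′`); first moments `θ_j‖Ψ_j‖² ≤ ⟨Ψ_j,K_βΨ_j⟩`
with `λ_{lo j} − θ_j ≤ s·gap_j` and `λ_0 − λ_{lo j} ≤ κ·gap_j`, `gap_j = λ_{lo_j} − λ_{le_j} > 0` (`lo_j = #{cl j′ < cl j}`, `le_j = #{cl j′ ≤ cl j}`).  If `M(ε + clusterDelta M κ ε s M) ≤ 1/2` then
for every `j`: `Σ_{cl j′<cl j}⟨Ψ_j,e_{j′}⟩² + (‖Ψ_j‖² − Σ_{cl j′≤cl j}⟨Ψ_j,e_{j′}⟩²) ≤ clusterDelta M κ ε s M · ‖Ψ_j‖²` — the tree's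
`ClusterInd.cluster_induction` transported through `PhysL2.toL2`. [cite: ReedSimonIV1978, Thm. XIII.1] -/
theorem cluster_concentration (hanti : Antitone fun k => levelValue su2Rep L β k) {M : ℕ} (Ψ : Fin M → GaugeConfig 3 L SU2 → ℝ)
    (hΨ : ∀ j, IsPhys (Ψ j)) (hΨpos : ∀ j, 0 < l2 (Ψ j) (Ψ j)) (cl : Fin M → ℕ) (hcl : Monotone cl) (lo le : Fin M → ℕ)
    (hlo : ∀ j, (univ.filter fun j' => cl j' < cl j).card = lo j) (hle : ∀ j, (univ.filter fun j' => cl j' ≤ cl j).card = le j) {κ ε s : ℝ} (hκ : 0 ≤ κ) (hε : 0 ≤ ε) (hs : 0 ≤ s)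
    (hgram : ∀ j j', j ≠ j' → |l2 (Ψ j) (Ψ j')| ≤ ε * Real.sqrt (l2 (Ψ j) (Ψ j)) * Real.sqrt (l2 (Ψ j') (Ψ j')))
    (θ : Fin M → ℝ) (hθ : ∀ j, θ j * l2 (Ψ j) (Ψ j) ≤ qform su2Rep β (Ψ j) (Ψ j))
    (hgap : ∀ j, 0 < levelValue su2Rep L β (lo j) - levelValue su2Rep L β (le j))
    (hsj : ∀ j, levelValue su2Rep L β (lo j) - θ j ≤ s * (levelValue su2Rep L β (lo j) - levelValue su2Rep L β (le j)))
    (hκj : ∀ j, levelValue su2Rep L β 0 - levelValue su2Rep L β (lo j) ≤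
      κ * (levelValue su2Rep L β (lo j) - levelValue su2Rep L β (le j)))
    (hsmall : (M : ℝ) * (ε + clusterDelta M κ ε s M) ≤ 1 / 2) (j : Fin M) :
    (∑ j' ∈ univ.filter (fun j' => cl j' < cl j), l2 (Ψ j) ((e j' : physSubmodule L) : GaugeConfig 3 L SU2 → ℝ) ^ 2) +
      (l2 (Ψ j) (Ψ j) - ∑ j' ∈ univ.filter (fun j' => cl j' ≤ cl j), l2 (Ψ j) ((e j' : physSubmodule L) : GaugeConfig 3 L SU2 → ℝ) ^ 2)
      ≤ clusterDelta M κ ε s M * l2 (Ψ j) (Ψ j) := by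
  classical
  let x : Fin M → Lp ℝ 2 (configMeasure SU2 L) := fun j => toL2 ⟨Ψ j, hΨ j⟩
  let eh : Fin M → Lp ℝ 2 (configMeasure SU2 L) := fun j => toL2 (e j)
  have hxe : ∀ j (j' : Fin M), ⟪x j, eh j'⟫ = l2 (Ψ j) ((e j' : physSubmodule L) : GaugeConfig 3 L SU2 → ℝ) :=
    fun j j' => inner_toL2 _ _
  have hxx : ∀ j j', ⟪x j, x j'⟫ = l2 (Ψ j) (Ψ j') := fun j j' => inner_toL2 _ _
  have hnx2 : ∀ j, ‖x j‖ ^ 2 = l2 (Ψ j) (Ψ j) := fun j => norm_sq_toL2 _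
  have hnx : ∀ j, ‖x j‖ = Real.sqrt (l2 (Ψ j) (Ψ j)) := fun j => by
    rw [← hnx2, Real.sqrt_sq (norm_nonneg _)]
  have hnxpos : ∀ j, 0 < ‖x j‖ := fun j => by rw [hnx]; exact Real.sqrt_pos.2 (hΨpos j)
  have heh : Orthonormal ℝ eh := by
    rw [orthonormal_iff_ite]
    intro i l
    show ⟪toL2 (e i), toL2 (e l)⟫ = _
    rw [inner_toL2, hon]
    simp only [Fin.val_eq_val]
  let Φ : Fin M → Lp ℝ 2 (configMeasure SU2 L) := fun j => (‖x j‖)⁻¹ • x j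
  have hΦ1 : ∀ j, ‖Φ j‖ = 1 := fun j => norm_smul_inv_norm (norm_pos_iff.1 (hnxpos j))
  have hΦe : ∀ j (j' : Fin M), ⟪Φ j, eh j'⟫ ^ 2 = l2 (Ψ j) ((e j' : physSubmodule L) : GaugeConfig 3 L SU2 → ℝ) ^ 2 / l2 (Ψ j) (Ψ j) := by
    intro j j'
    show ⟪(‖x j‖)⁻¹ • x j, eh j'⟫ ^ 2 = _
    rw [real_inner_smul_left, hxe, mul_pow, inv_pow, hnx2]
    field_simp
  have hgram' : ∀ j j', j ≠ j' → |⟪Φ j, Φ j'⟫| ≤ ε := by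
    intro j j' hjj
    show |⟪(‖x j‖)⁻¹ • x j, (‖x j'‖)⁻¹ • x j'⟫| ≤ ε
    rw [real_inner_smul_left, real_inner_smul_right, hxx, abs_mul, abs_mul, abs_inv, abs_inv, abs_norm, abs_norm]
    have h := hgram j j' hjj
    rw [← hnx, ← hnx] at h
    have hp := mul_pos (hnxpos j) (hnxpos j')
    rw [inv_mul_le_iff₀ (hnxpos j), inv_mul_le_iff₀ (hnxpos j')]
    nlinarith [h]
  -- hypothesis (henergy) transported via §3
  have henergy' : ∀ j, 1 - ∑ j' ∈ univ.filter (fun j' => cl j' ≤ cl j), ⟪Φ j, eh j'⟫ ^ 2 ≤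
      s + κ * ∑ j' ∈ univ.filter (fun j' => cl j' < cl j), ⟪Φ j, eh j'⟫ ^ 2 := by
    intro j
    simp only [hΦe]
    rw [← sum_div, ← sum_div,
      sum_filter_eq_sum_range _ (mem_filter_le_iff cl hcl j) (fun k => l2 (Ψ j) ((e k : physSubmodule L) : _) ^ 2),
      sum_filter_eq_sum_range _ (mem_filter_lt_iff cl hcl j) (fun k => l2 (Ψ j) ((e k : physSubmodule L) : _) ^ 2), hlo, hle]
    have hN := hΨpos j
    have hout := out_le_of_firstMoment e hon heig hdom hanti (hΨ j)
      (show lo j ≤ le j by rw [← hlo, ← hle]; exact (card_filter_lt_le_card_filter_le cl j).1) (hθ j)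
    set N := l2 (Ψ j) (Ψ j) with hNdef
    set Slo := ∑ k ∈ range (lo j), l2 (Ψ j) ((e k : physSubmodule L) : GaugeConfig 3 L SU2 → ℝ) ^ 2 with hSlo
    set Sle := ∑ k ∈ range (le j), l2 (Ψ j) ((e k : physSubmodule L) : GaugeConfig 3 L SU2 → ℝ) ^ 2 with hSle
    set gap := levelValue su2Rep L β (lo j) - levelValue su2Rep L β (le j) with hgapdef
    have hg := hgap j
    have hSlo0 : 0 ≤ Slo := sum_nonneg fun k _ => sq_nonneg _
    have h1 : (levelValue su2Rep L β (lo j) - θ j) * N ≤ s * gap * N :=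
      mul_le_mul_of_nonneg_right (hsj j) hN.le
    have h2 : (levelValue su2Rep L β 0 - levelValue su2Rep L β (lo j)) * Slo ≤ κ * gap * Slo :=
      mul_le_mul_of_nonneg_right (hκj j) hSlo0
    have key : N - Sle ≤ s * N + κ * Slo := by
      refine le_of_mul_le_mul_left ?_ hg
      calc gap * (N - Sle) ≤ (levelValue su2Rep L β (lo j) - θ j) * N +
            (levelValue su2Rep L β 0 - levelValue su2Rep L β (lo j)) * Slo := hout
        _ ≤ s * gap * N + κ * gap * Slo := add_le_add h1 h2
        _ = gap * (s * N + κ * Slo) := by ring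
    change 1 - Sle / N ≤ s + κ * (Slo / N)
    have e1 : 1 - Sle / N = (N - Sle) / N := by field_simp
    have e2 : s + κ * (Slo / N) = (s * N + κ * Slo) / N := by field_simp
    rw [e1, e2]
    exact div_le_div_of_nonneg_right key hN.le
  have hmain := cluster_induction hκ hε hs eh heh cl hcl Φ hΦ1 hgram' henergy' hsmall j
  have hmono := clusterDelta_mono (M := M) (κ := κ) (ε := ε) (s := s) hκ hε hs j.2.le
  have hN := hΨpos j
  simp only [hΦe, ← sum_div] at hmain
  set N := l2 (Ψ j) (Ψ j)
  set Slo := ∑ j' ∈ univ.filter (fun j' => cl j' < cl j), l2 (Ψ j) ((e j' : physSubmodule L) : GaugeConfig 3 L SU2 → ℝ) ^ 2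
  set Sle := ∑ j' ∈ univ.filter (fun j' => cl j' ≤ cl j), l2 (Ψ j) ((e j' : physSubmodule L) : GaugeConfig 3 L SU2 → ℝ) ^ 2
  have h1 : (Slo + (N - Sle)) / N ≤ clusterDelta M κ ε s M := by
    have : (Slo + (N - Sle)) / N = Slo / N + (1 - Sle / N) := by field_simp
    rw [this]; exact hmain.trans hmono
  rwa [div_le_iff₀ hN] at h1

include hon heig hdom in
/-- ★★ **CLUSTER CONCENTRATION, `ℕ`-indexed form** (the currency of `SpecSum`: coefficients `⟨Ψ_j, e_k⟩`, `k < lo_j`, `k < le_j`):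
`Σ_{k<lo_j}⟨Ψ_j,e_k⟩² + (‖Ψ_j‖² − Σ_{k<le_j}⟨Ψ_j,e_k⟩²) ≤ clusterDelta M κ ε s M · ‖Ψ_j‖²`. [cite: ReedSimonIV1978, Thm. XIII.1] -/
theorem cluster_concentration_range (hanti : Antitone fun k => levelValue su2Rep L β k) {M : ℕ} (Ψ : Fin M → GaugeConfig 3 L SU2 → ℝ)
    (hΨ : ∀ j, IsPhys (Ψ j)) (hΨpos : ∀ j, 0 < l2 (Ψ j) (Ψ j)) (cl : Fin M → ℕ) (hcl : Monotone cl) (lo le : Fin M → ℕ)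
    (hlo : ∀ j, (univ.filter fun j' => cl j' < cl j).card = lo j) (hle : ∀ j, (univ.filter fun j' => cl j' ≤ cl j).card = le j) {κ ε s : ℝ} (hκ : 0 ≤ κ) (hε : 0 ≤ ε) (hs : 0 ≤ s)
    (hgram : ∀ j j', j ≠ j' → |l2 (Ψ j) (Ψ j')| ≤ ε * Real.sqrt (l2 (Ψ j) (Ψ j)) * Real.sqrt (l2 (Ψ j') (Ψ j')))
    (θ : Fin M → ℝ) (hθ : ∀ j, θ j * l2 (Ψ j) (Ψ j) ≤ qform su2Rep β (Ψ j) (Ψ j))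
    (hgap : ∀ j, 0 < levelValue su2Rep L β (lo j) - levelValue su2Rep L β (le j))
    (hsj : ∀ j, levelValue su2Rep L β (lo j) - θ j ≤ s * (levelValue su2Rep L β (lo j) - levelValue su2Rep L β (le j)))
    (hκj : ∀ j, levelValue su2Rep L β 0 - levelValue su2Rep L β (lo j) ≤
      κ * (levelValue su2Rep L β (lo j) - levelValue su2Rep L β (le j)))
    (hsmall : (M : ℝ) * (ε + clusterDelta M κ ε s M) ≤ 1 / 2) (j : Fin M) :
    (∑ k ∈ range (lo j), l2 (Ψ j) ((e k : physSubmodule L) : GaugeConfig 3 L SU2 → ℝ) ^ 2) +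
      (l2 (Ψ j) (Ψ j) - ∑ k ∈ range (le j), l2 (Ψ j) ((e k : physSubmodule L) : GaugeConfig 3 L SU2 → ℝ) ^ 2)
      ≤ clusterDelta M κ ε s M * l2 (Ψ j) (Ψ j) := by
  have h := cluster_concentration e hon heig hdom hanti Ψ hΨ hΨpos cl hcl lo le hlo hle hκ hε hs hgram θ hθ hgap hsj hκj hsmall j
  rwa [sum_filter_eq_sum_range _ (mem_filter_lt_iff cl hcl j) (fun k => l2 (Ψ j) ((e k : physSubmodule L) : _) ^ 2),
    sum_filter_eq_sum_range _ (mem_filter_le_iff cl hcl j) (fun k => l2 (Ψ j) ((e k : physSubmodule L) : _) ^ 2), hlo, hle] at h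

/-- The in-cluster window as a difference of initial segments: `Σ_{lo ≤ k < le} = Σ_{k<le} − Σ_{k<lo}`. [folklore] -/
theorem sum_Ico_eq_sub {lo le : ℕ} (h : lo ≤ le) (f : ℕ → ℝ) :
    ∑ k ∈ Ico lo le, f k = ∑ k ∈ range le, f k - ∑ k ∈ range lo, f k := by
  rw [range_eq_Ico, range_eq_Ico, ← sum_Ico_consecutive f (Nat.zero_le _) h]
  ring

include hon heig hdom in
/-- ★★ **IN-CLUSTER CONCENTRATION** (the form F9 consumes: `‖Ψ_j‖² ≤ (1 + ϑ)·in(Ψ_j)` up to rewriting): under the hypotheses of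
`cluster_concentration`, `(1 − δ)‖Ψ_j‖² ≤ Σ_{lo_j ≤ k < le_j}⟨Ψ_j,e_k⟩²` and `Σ_{k<lo_j}⟨Ψ_j,e_k⟩² ≤ δ‖Ψ_j‖²`, `δ = clusterDelta M κ ε s M`.
[cite: ReedSimonIV1978, Thm. XIII.1] -/
theorem cluster_concentration_in (hanti : Antitone fun k => levelValue su2Rep L β k) {M : ℕ} (Ψ : Fin M → GaugeConfig 3 L SU2 → ℝ)
    (hΨ : ∀ j, IsPhys (Ψ j)) (hΨpos : ∀ j, 0 < l2 (Ψ j) (Ψ j)) (cl : Fin M → ℕ) (hcl : Monotone cl) (lo le : Fin M → ℕ)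
    (hlo : ∀ j, (univ.filter fun j' => cl j' < cl j).card = lo j) (hle : ∀ j, (univ.filter fun j' => cl j' ≤ cl j).card = le j) {κ ε s : ℝ} (hκ : 0 ≤ κ) (hε : 0 ≤ ε) (hs : 0 ≤ s)
    (hgram : ∀ j j', j ≠ j' → |l2 (Ψ j) (Ψ j')| ≤ ε * Real.sqrt (l2 (Ψ j) (Ψ j)) * Real.sqrt (l2 (Ψ j') (Ψ j')))
    (θ : Fin M → ℝ) (hθ : ∀ j, θ j * l2 (Ψ j) (Ψ j) ≤ qform su2Rep β (Ψ j) (Ψ j))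
    (hgap : ∀ j, 0 < levelValue su2Rep L β (lo j) - levelValue su2Rep L β (le j))
    (hsj : ∀ j, levelValue su2Rep L β (lo j) - θ j ≤ s * (levelValue su2Rep L β (lo j) - levelValue su2Rep L β (le j)))
    (hκj : ∀ j, levelValue su2Rep L β 0 - levelValue su2Rep L β (lo j) ≤
      κ * (levelValue su2Rep L β (lo j) - levelValue su2Rep L β (le j)))
    (hsmall : (M : ℝ) * (ε + clusterDelta M κ ε s M) ≤ 1 / 2) (j : Fin M) :
    (1 - clusterDelta M κ ε s M) * l2 (Ψ j) (Ψ j) ≤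
        ∑ k ∈ Ico (lo j) (le j), l2 (Ψ j) ((e k : physSubmodule L) : GaugeConfig 3 L SU2 → ℝ) ^ 2 ∧
      ∑ k ∈ range (lo j), l2 (Ψ j) ((e k : physSubmodule L) : GaugeConfig 3 L SU2 → ℝ) ^ 2 ≤
        clusterDelta M κ ε s M * l2 (Ψ j) (Ψ j) ∧
      ∑ k ∈ range (le j), l2 (Ψ j) ((e k : physSubmodule L) : GaugeConfig 3 L SU2 → ℝ) ^ 2 ≤ l2 (Ψ j) (Ψ j) := by
  have h := cluster_concentration_range e hon heig hdom hanti Ψ hΨ hΨpos cl hcl lo le hlo hle hκ hε hs hgram θ hθ hgap hsj hκj hsmall j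
  have hB := (firstMoment_split e hon heig hdom (hΨ j) (le j)).1
  have hlo0 : 0 ≤ ∑ k ∈ range (lo j), l2 (Ψ j) ((e k : physSubmodule L) : GaugeConfig 3 L SU2 → ℝ) ^ 2 :=
    sum_nonneg fun k _ => sq_nonneg _
  rw [sum_Ico_eq_sub (show lo j ≤ le j by rw [← hlo, ← hle]; exact (card_filter_lt_le_card_filter_le cl j).1)]
  refine ⟨by linarith, by linarith, hB⟩

end Split

end Summit.QuantumFields.YangMills.Theorems.FemtoTransferGap.ClusterConc

end
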